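import Summits.CriticalPhenomena.PercolationContinuityZ3.Theorems.PercNearOneGluingNoHeavyQuantNearRouteShape
import HarnessLib

/-!
# QUANT lane R8, T-DEC: THE FARTHEST-NEAR ROUTE CERTIFICATE on a progression `lo·j + K·s` — the route rule for LONG TAILS `K > 3lo/2`
# (census-1 gen 31)

builds on p205010 (kernel theorem, internal audit signed; external expert review pending)

Support file (`--supports stmt-CriticalPhenomena-4575`), QUANT lane seat prim-quant-census-1 (gen 31); memo
`run/shared/lean/prim/quant/prim-quant-census-1/g31/HUB-GENERAL-G31.md` §0 (7).  Theorems only, standard axioms, no sorries.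

THE RULE (found numerically, memo §0 (7); code/exp10–exp12).  For shapes `lo < K ≤ 3lo/2` the near certificate `sdec_progressionLK` ships a charged
low `l` to `l + K⌈3(T−2l)/(2K)⌉` (credit gate `ρ ≤ 2/3`).  For LONGER tails no fixed credit threshold works (exp9), but the FARTHEST-NEAR INJECTIVE
rule does, from width `j₀ ≈ K/lo + 2` on: at gate `T` let `t* = ⌈(T − lo·j)/K⌉ − 1` (so `lo·j + K·t*` is the largest atom `< T`) and ship the
charged low `lo·j + K·s` (`2(lo·j + Ks) < T`) ENTIRELY to the atom `lo·j + K·(t* − s)`.  When `K < lo·j`: `2s < t*` (the target is above the low),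
the target is `< T` (near: cost-free), `T < low + target = 2lo·j + K·t*` (compatible), and distinct lows get distinct targets; so by
`sdec_of_nearRoutes_charged` the law is SDEC as soon as the per-route CAPACITY `max(x, ρ)(u_s + u_{t*−s}) ≤ u_{t*−s}`,
`ρ = (T − 2(lo·j+Ks))/(K(t* − 2s))`, holds — which is the ONLY hypothesis left (`sdec_farthestNear`, stated with `t*` characterised by
`lo·j + K·t* < T ≤ lo·j + K·(t*+1)` rather than by the ceiling).  Numerically (exact rationals, exp12/exp12x) the capacity holds with the
elementary-symmetric mass bound of `…QuantElemSymmBound` on every tested instance from `j₀(1,3) = 4`, `j₀(2,7) = 4`, `j₀(1,4) = 5`, `j₀(2,9) = 6`,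
`j₀(1,5) = 7`, `j₀(1,6) = 8`; its closed-form discharge is the successor's item (memo §3 item 2).

HONEST STATUS.  A tool; no census row changes.  `SiblingStep`, `GluedDominated'`, `SDECConvClosed`, `FarTreeRow` OPEN; RATE class (log\*) / honest
sentence of `run/shared/lean/prim/quant/README.md` unchanged.  [this work].  Nothing here is cited as a published result.  The gluing rows served
[cite: KozmaNitzan2024, Conjecture 3 (p. 15)]; product measure [cite: Grimmett1999, §1.3 p. 10].
-/

noncomputable section

open scoped BigOperators

namespace Summit.CriticalPhenomena.PercolationContinuityZ3.Theorems
namespace Quant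
namespace LawDec

open Finset

/-- **the farthest-near route certificate** for a law on the progression `lo·j + K·s` with `K < lo·j`: if at every gate `T ≤ T₀` (the mean),
with `t*` the index of the largest atom below `T` (`lo·j + K·t* < T ≤ lo·j + K(t*+1)`), every charged low `lo·j + K·s` (`2(lo·j+Ks) < T`, positive
mass; then automatically `2s < t*`) satisfies the capacity `max(x, ρ)·(u_s + u_{t*−s}) ≤ u_{t*−s}` with `ρ = (T − 2(lo·j+Ks))/(K(t*−2s))`, then the
law is `SDEC x ((lo+K)j)`. [this work] -/
theorem sdec_farthestNear (lo K j : ℕ) (x T₀ : ℝ) (μ : ℕ → ℝ) (hK : 0 < K) (hjK : K < lo * j) (hx0 : 0 < x) (hx1 : x < 1)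
    (hμ0 : ∀ h, 0 ≤ μ h) (hμM : ∀ h, (lo + K) * j < h → μ h = 0) (hμ1 : ∑ h ∈ Finset.range ((lo + K) * j + 1), μ h = 1)
    (hT : ∑ h ∈ Finset.range ((lo + K) * j + 1), (h : ℝ) * μ h = T₀) (hT0 : 0 < T₀)
    (hta : x * (((lo + K) * j : ℕ) : ℝ) ≤ T₀) (hsupp : ∀ h, μ h ≠ 0 → ∃ s, h = lo * j + K * s)
    (hcap : ∀ T : ℝ, 0 < T → T ≤ T₀ → ∀ t s : ℕ, (lo : ℝ) * j + K * t < T → T ≤ (lo : ℝ) * j + K * ((t : ℝ) + 1) → 2 * s < t →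
      2 * ((lo : ℝ) * j + K * s) < T → 0 < μ (lo * j + K * s) →
      max x ((T - 2 * ((lo : ℝ) * j + K * s)) / ((K : ℝ) * ((t - 2 * s : ℕ) : ℝ))) * (μ (lo * j + K * s) + μ (lo * j + K * (t - s)))
        ≤ μ (lo * j + K * (t - s))) :
    SDEC x ((lo + K) * j) μ := by
  have hK0 : (0 : ℝ) < K := by exact_mod_cast hK
  have hjKR : (K : ℝ) < (lo : ℝ) * j := by exact_mod_cast hjK
  -- the gate analysis: `t* = ⌈(T − lo j)/K⌉ − 1`, and what a charged low looks like
  have gate : ∀ T : ℝ, ∀ l : ℕ, 2 * (l : ℝ) < T → 0 < μ l →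
      ∃ s : ℕ, l = lo * j + K * s ∧ 2 * s < ⌈(T - (lo : ℝ) * j) / K⌉₊ - 1 ∧
        (lo : ℝ) * j + K * (((⌈(T - (lo : ℝ) * j) / K⌉₊ - 1 : ℕ) : ℝ)) < T ∧
        T ≤ (lo : ℝ) * j + K * ((((⌈(T - (lo : ℝ) * j) / K⌉₊ - 1 : ℕ) : ℝ)) + 1) := by
    intro T l hlT hμl
    obtain ⟨s, hs⟩ := hsupp l hμl.ne'
    have hljR : (lo : ℝ) * j ≤ l := by rw [hs]; push_cast; nlinarith [Nat.zero_le (K * s)]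
    set A : ℝ := (T - (lo : ℝ) * j) / K with hA
    have hA1 : 1 < A := by rw [hA, lt_div_iff₀ hK0]; linarith
    set c : ℕ := ⌈A⌉₊ with hc
    have hcA : A ≤ c := Nat.le_ceil A
    have hcA1 : (c : ℝ) < A + 1 := Nat.ceil_lt_add_one (by linarith)
    have hc2 : 2 ≤ c := by
      have h1c : (1 : ℝ) < c := lt_of_lt_of_le hA1 hcA
      have : 1 < c := by exact_mod_cast h1c
      omega
    have ect : (((c - 1 : ℕ)) : ℝ) = (c : ℝ) - 1 := by rw [Nat.cast_sub (by omega)]; simp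
    have eKA : (K : ℝ) * A = T - (lo : ℝ) * j := by rw [hA]; field_simp
    have hKt : (lo : ℝ) * j + K * (((c - 1 : ℕ)) : ℝ) < T := by
      rw [ect]; nlinarith [mul_lt_mul_of_pos_left hcA1 hK0]
    have hTc : T ≤ (lo : ℝ) * j + K * ((((c - 1 : ℕ)) : ℝ) + 1) := by
      rw [ect]; nlinarith [mul_le_mul_of_nonneg_left hcA hK0.le]
    refine ⟨s, hs, ?_, hKt, hTc⟩
    -- `2s < t*`: `2Ks < T − 2lo j ≤ K t* − (lo j − K) < K t*`
    have hsR : 2 * ((K : ℝ) * s) < K * (((c - 1 : ℕ)) : ℝ) := by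
      have : 2 * ((lo : ℝ) * j + K * s) < T := by rw [hs] at hlT; push_cast at hlT; linarith
      linarith
    have : ((2 * s : ℕ) : ℝ) < ((c - 1 : ℕ) : ℝ) := by push_cast; nlinarith
    exact_mod_cast this
  refine sdec_of_nearRoutes_charged x T₀ ((lo + K) * j) μ (fun T l => 2 * lo * j + K * (⌈(T - (lo : ℝ) * j) / K⌉₊ - 1) - l)
    hx0 hx1 hμ0 hμM hμ1 hT hT0 hta ?_ ?_
  · intro T hTpos hTle l hl1 hlT hμl
    obtain ⟨s, hs, h2s, hKt, hTc⟩ := gate T l hlT hμl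
    set t : ℕ := ⌈(T - (lo : ℝ) * j) / K⌉₊ - 1 with ht
    have hst : s ≤ t := by omega
    have h2st : 2 * s ≤ t := by omega
    have hl_le : l ≤ 2 * lo * j + K * t := by
      rw [hs]; nlinarith [Nat.mul_le_mul_left K hst, Nat.zero_le (lo * j)]
    have etv : 2 * lo * j + K * t - l = lo * j + K * (t - s) := by
      zify [hst, hl_le]; rw [hs]; push_cast; ring
    show l < 2 * lo * j + K * t - l ∧ (((2 * lo * j + K * t - l : ℕ)) : ℝ) < T ∧ T < (l : ℝ) + (((2 * lo * j + K * t - l : ℕ)) : ℝ) ∧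
      max x ((T - 2 * (l : ℝ)) / ((((2 * lo * j + K * t - l : ℕ)) : ℝ) - l)) * (μ l + μ (2 * lo * j + K * t - l))
        ≤ μ (2 * lo * j + K * t - l)
    rw [etv]
    have ec : (((lo * j + K * (t - s) : ℕ)) : ℝ) = (lo : ℝ) * j + K * ((t : ℝ) - s) := by
      push_cast [Nat.cast_sub hst]; ring
    have el : (l : ℝ) = (lo : ℝ) * j + K * s := by rw [hs]; push_cast; ring
    have hs0 : (0 : ℝ) ≤ K * s := by positivity
    refine ⟨?_, ?_, ?_, ?_⟩
    · rw [hs]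
      have : K * s < K * (t - s) := Nat.mul_lt_mul_of_pos_left (by omega) hK
      omega
    · rw [ec]; nlinarith
    · rw [ec, el]; nlinarith
    · have ed : (((lo * j + K * (t - s) : ℕ)) : ℝ) - l = (K : ℝ) * (((t - 2 * s : ℕ)) : ℝ) := by
        rw [ec, el]; push_cast [Nat.cast_sub h2st]; ring
      rw [ed, el, hs]
      have hlT' : 2 * ((lo : ℝ) * j + K * s) < T := by rw [← el]; exact hlT
      have hμl' : 0 < μ (lo * j + K * s) := by rw [← hs]; exact hμl
      exact hcap T hTpos hTle t s hKt hTc h2s hlT' hμl'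
  · -- injectivity on charged lows: `l ↦ N − l` with `l, l' ≤ N = 2lo j + K t*`
    intro T hTpos hTle l l' hl1 hlT hμl hl1' hlT' hμl' heq
    obtain ⟨s, hs, h2s, _, _⟩ := gate T l hlT hμl
    obtain ⟨s', hs', h2s', _, _⟩ := gate T l' hlT' hμl'
    set t : ℕ := ⌈(T - (lo : ℝ) * j) / K⌉₊ - 1 with ht
    have hl_le : l ≤ 2 * lo * j + K * t := by
      rw [hs]; nlinarith [Nat.mul_le_mul_left K (by omega : s ≤ t), Nat.zero_le (lo * j)]
    have hl'_le : l' ≤ 2 * lo * j + K * t := by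
      rw [hs']; nlinarith [Nat.mul_le_mul_left K (by omega : s' ≤ t), Nat.zero_le (lo * j)]
    change 2 * lo * j + K * t - l = 2 * lo * j + K * t - l' at heq
    set N : ℕ := 2 * lo * j + K * t with hN
    omega

end LawDec
end Quant
end Summit.CriticalPhenomena.PercolationContinuityZ3.Theorems
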